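import Mathlib.NumberTheory.Padics.Complex
import Literature.NumberTheory.Automorphic.AdicCompletionLocalField
import Literature.NumberTheory.GaloisRepresentations.DecompositionGroupOfCompletion
import Literature.NumberTheory.GaloisRepresentations.DegreeOnePrimesFixedField
import HarnessLib

/-!
# Line `Sketch` for the crux `ReciprocityUpToIrreducibility` (item stmt-Langlands-14328), wave N14-B:
# finite local inertia image ⇒ finite image of every inertia group above `v`

Support file (closes nothing; stub `stub_finite_inertia_of_finite_local_inertia` of the registered
skeleton of line `Sketch`, continuation lead c9).  Pure bookkeeping, any rank `n` and any
topological coefficient ring `A`: let `K` be a number field, `v` a finite place, `K_v` its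
completion, `res : Γ_{K_v} → Γ_K` the restriction along the chosen embedding `K̄ → \bar K_v`
(`absGaloisRestrict K K_v`), `ρ : Γ_K → GL_n(A)` a continuous representation and
`ρ|_{Γ_{K_v}} = ρ ∘ res` (`FramedGaloisRep.toLocal`).  If the image of the local inertia group
`I_{K_v} = absInertia K_v` under `ρ|_{Γ_{K_v}}` is finite, then the image under `ρ` of the inertia
group `I_𝔓 ≤ Γ_K` of EVERY prime `𝔓` of `\bar ℤ_K` above `v` is finite:

* §1 `image_inertia_smul_subset`, `finite_image_inertia_smul` — for `τ ∈ Γ_K`,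
  `I_{τ • 𝔓} = τ I_𝔓 τ⁻¹` (tree `DegreeOnePrimes.conj_mem_inertia_of_mem_inertia_smul`), so
  `ρ(I_{τ • 𝔓}) ⊆ ρ(τ) ρ(I_𝔓) ρ(τ)⁻¹`, the image of a finite set (any field `K`).
* §2 `image_inertia_adicCompletionPrime_eq` — for the distinguished prime
  `𝔓₀ = adicCompletionPrime K v` cut out by the embedding, `I_{𝔓₀} = res (I_{K_v})` (Neukirch,
  Ch. II (9.6); tree `inertia_adicCompletionPrime_eq_map_absInertia` /
  `map_inertia_adicCompletionPrime`), so `ρ(I_{𝔓₀}) = ρ|_{Γ_{K_v}}(I_{K_v})` is the given finite set;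
  and every `𝔓 ∣ v` is `τ • 𝔓₀` for some `τ` (`Γ_K` is transitive on the primes above `v`:
  Neukirch, Ch. I (9.1), tree `exists_smul_eq_of_mem_primesAbove_holds`):
  `finite_image_inertia_of_finite_image_absInertia`.
* §3 the stub, verbatim (coefficients `ℚ̄_ℓ = PadicAlgCl ℓ`).

References: J. Neukirch, *Algebraic Number Theory* (1999), Ch. I §9 Prop. (9.1), Ch. II §9
Prop. (9.6) [NeukirchANT1999]; J.-P. Serre, *Abelian ℓ-adic representations and elliptic curves*
(1968), Ch. I §2.1 [SerreAbelianLadic1968].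
No new definitions; axioms `propext`, `Classical.choice`, `Quot.sound`.
-/

noncomputable section

set_option linter.dupNamespace false -- project-wide option (lakefile weak.linter.dupNamespace); `Summit.Langlands.Langlands` is the mandated namespace

open scoped NumberField Classical Polynomial Pointwise
open Filter IsDedekindDomain Polynomial Field
open Literature.NumberTheory.Automorphic Literature.NumberTheory.GaloisRepresentations

namespace Summit.Langlands.Langlands.Theorems.ReciprocityUpToIrreducibility

variable {K : Type} [Field K] {A : Type*} [CommRing A] [TopologicalSpace A] {n : ℕ}

/-! ## 1. Conjugate primes: `ρ(I_{τ • 𝔓}) ⊆ ρ(τ) ρ(I_𝔓) ρ(τ)⁻¹` -/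

/-- **`ρ(I_{τ • 𝔓}) ⊆ ρ(τ) ρ(I_𝔓) ρ(τ)⁻¹`**: the image of the inertia group of a conjugate prime is
contained in the conjugate of the image (`σ ∈ I_{τ • 𝔓} ⇒ τ⁻¹ σ τ ∈ I_𝔓`, tree
`DegreeOnePrimes.conj_mem_inertia_of_mem_inertia_smul`). [cite: SerreAbelianLadic1968, Ch. I §2.1] -/
theorem image_inertia_smul_subset (ρ : FramedGaloisRep K A n)
    (𝔓 : Ideal (absIntegers (𝓞 K) K)) (τ : absoluteGaloisGroup K) :
    ρ.toMonoidHom '' ((τ • 𝔓).inertia (absoluteGaloisGroup K) : Set (absoluteGaloisGroup K)) ⊆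
      (fun x => ρ τ * x * (ρ τ)⁻¹) ''
        (ρ.toMonoidHom '' (𝔓.inertia (absoluteGaloisGroup K) : Set (absoluteGaloisGroup K))) := by
  rintro _ ⟨σ, hσ, rfl⟩
  refine ⟨ρ (τ⁻¹ * σ * τ), ⟨_, DegreeOnePrimes.conj_mem_inertia_of_mem_inertia_smul hσ, rfl⟩, ?_⟩
  change ρ τ * ρ (τ⁻¹ * σ * τ) * (ρ τ)⁻¹ = ρ σ
  simp only [map_mul, map_inv]
  group

/-- **Finite image of `I_𝔓` ⇒ finite image of `I_{τ • 𝔓}`** (`image_inertia_smul_subset` and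
`Set.Finite.image`). [cite: SerreAbelianLadic1968, Ch. I §2.1] -/
theorem finite_image_inertia_smul (ρ : FramedGaloisRep K A n)
    {𝔓 : Ideal (absIntegers (𝓞 K) K)}
    (h : (ρ.toMonoidHom ''
      (𝔓.inertia (absoluteGaloisGroup K) : Set (absoluteGaloisGroup K))).Finite)
    (τ : absoluteGaloisGroup K) :
    (ρ.toMonoidHom '' ((τ • 𝔓).inertia (absoluteGaloisGroup K) :
      Set (absoluteGaloisGroup K))).Finite :=
  (h.image _).subset (image_inertia_smul_subset ρ 𝔓 τ)

/-! ## 2. The distinguished prime `𝔓₀ ∣ v`: `ρ(I_{𝔓₀}) = ρ|_{Γ_{K_v}}(I_{K_v})` -/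

variable [NumberField K]

/-- **`ρ(I_{𝔓₀}) = ρ|_{Γ_{K_v}}(I_{K_v})`** for the prime `𝔓₀ = adicCompletionPrime K v` above `v`
cut out by the chosen embedding `K̄ → \bar K_v`: the inertia group of `𝔓₀` is the image of the local
inertia group under `res : Γ_{K_v} → Γ_K` (Neukirch II (9.6), tree
`inertia_adicCompletionPrime_eq_map_absInertia`), and `ρ|_{Γ_{K_v}} = ρ ∘ res`.
[cite: NeukirchANT1999, Ch. II §9 Prop. (9.6)] -/
theorem image_inertia_adicCompletionPrime_eq (ρ : FramedGaloisRep K A n)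
    (v : HeightOneSpectrum (𝓞 K)) :
    ρ.toMonoidHom '' ((adicCompletionPrime K v).inertia (absoluteGaloisGroup K) :
        Set (absoluteGaloisGroup K)) =
      (fun g => ρ.toLocal v g) ''
        (absInertia (v.adicCompletion K) : Set (absoluteGaloisGroup (v.adicCompletion K))) := by
  rw [← Subgroup.coe_map, map_inertia_adicCompletionPrime K v ρ.toMonoidHom, Subgroup.coe_map]
  rfl

/-- **Finite local inertia image ⇒ finite image of every `I_𝔓`, `𝔓 ∣ v`** (any coefficient ring,
any rank): `image_inertia_adicCompletionPrime_eq` for `𝔓₀`, transitivity of `Γ_K` on the primes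
above `v` (`exists_smul_eq_of_mem_primesAbove_holds`) and `finite_image_inertia_smul`.
[cite: NeukirchANT1999, Ch. II §9 Prop. (9.6) and Ch. I §9 Prop. (9.1)] -/
theorem finite_image_inertia_of_finite_image_absInertia (ρ : FramedGaloisRep K A n)
    (v : HeightOneSpectrum (𝓞 K))
    (h : ((fun g => ρ.toLocal v g) ''
      (absInertia (v.adicCompletion K) : Set (absoluteGaloisGroup (v.adicCompletion K)))).Finite)
    {𝔓 : Ideal (absIntegers (𝓞 K) K)} (h𝔓 : 𝔓 ∈ v.primesAbove) :
    (ρ.toMonoidHom '' (𝔓.inertia (absoluteGaloisGroup K) : Set (absoluteGaloisGroup K))).Finite := by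
  obtain ⟨τ, rfl⟩ := HeightOneSpectrum.exists_smul_eq_of_mem_primesAbove_holds
    (adicCompletionPrime_mem_primesAbove K v) h𝔓
  refine finite_image_inertia_smul ρ ?_ τ
  rwa [image_inertia_adicCompletionPrime_eq]

/-! ## 3. The stub -/

/-- **stub N14-B (finite local inertia image ⇒ finite image of every inertia group above `v`, any rank).**
If the image of the local inertia group `I_{K_v} = absInertia K_v` under `ρ|_{Γ_{K_v}}` is finite, then
for every prime `𝔓` of `\bar ℤ_K` above `v` the image `ρ(I_𝔓)` is finite: `I_{𝔓₀} = res (I_{K_v})` for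
the distinguished prime `𝔓₀ ∣ v` (Neukirch II (9.6)), every `𝔓 ∣ v` is `τ • 𝔓₀` (Neukirch I (9.1))
and `ρ(I_{τ • 𝔓₀}) ⊆ ρ(τ) ρ(I_{𝔓₀}) ρ(τ)⁻¹` (`finite_image_inertia_of_finite_image_absInertia`).
[cite: NeukirchANT1999, Ch. II §9 Prop. (9.6) and Ch. I §9 Prop. (9.1)] -/
theorem stub_finite_inertia_of_finite_local_inertia :
    ∀ (K : Type) [Field K] [NumberField K] (ℓ : ℕ) [Fact ℓ.Prime] (n : ℕ)
      (ρ : FramedGaloisRep K (PadicAlgCl ℓ) n) (v : HeightOneSpectrum (𝓞 K)),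
      ((fun g => ρ.toLocal v g) ''
        (absInertia (v.adicCompletion K) :
          Set (Field.absoluteGaloisGroup (v.adicCompletion K)))).Finite →
      ∀ 𝔓 ∈ v.primesAbove,
        (ρ.toMonoidHom '' (𝔓.inertia (Field.absoluteGaloisGroup K) :
          Set (Field.absoluteGaloisGroup K))).Finite :=
  fun _K _ _ _ℓ _ _n ρ v h _𝔓 h𝔓 => finite_image_inertia_of_finite_image_absInertia ρ v h h𝔓

end Summit.Langlands.Langlands.Theorems.ReciprocityUpToIrreducibility

end
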